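import Summits.QuantumFields.BalabanUV.T4Continuum.Support.B13StepEnvelopeEndUniform
import Summits.QuantumFields.BalabanUV.T4Continuum.Support.B13StepEndInsOpBalaban

/-!
# B13StepEnvelopeEndBalaban — NE5 ∕ U3: THE CAUCHY-ENVELOPE END FACE OF RECORD (E9[rec], re-pointed over a sub-slot, R20), READ AT BAŁABAN's
# TIER-B BACKGROUND — W1 PRODUCED by the row owner's `B13ReadingsRecord` (p224830) BY NAME, the arithmetic letters ELIMINATED by this lineage's
# `B13StepEnvelopeEndSub` ∕ `B13StepEnvelopeEndUniform` (p216841 ∕ p218872) BY NAME; per pair of runs, and η-UNIFORMLY (`∃ C₅` outermost)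

Cell `pub-balaban`, unit `b2b-balaban-t4-ne5-formalise-leaf-03` (NE5 formalisation swarm, LEAF PROVER 03, gen 12; lineage FOLLOWER under CLAIM RULE 1∕3 of
the E9[rec] lineage `B13StepEnvelopeEnd` p214842 → `…Arithmetic` p214993 → `…Sub` p216841 → `…MeasOp` p217285 → `…Uniform` p218872 → `…Window` p218923 →
`…Substrate` p222736; journal INTENT `HOME/CLAIMS.log` 2026-08-20T16:18Z).  THE E9-ROAD TWIN of `B13StepEndInsOpBalaban` (p225077, leaf-10 gen 8: the
E1-insOp road; owner ruling R50 «the twin road») and of the tower road's `OutputRateTowerArithmetic` §3.  Imports `B13StepEnvelopeEndUniform` and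
`B13StepEndInsOpBalaban` (for `sqrt_rate_pos_lt_one` ∕ `c1_balaban_nonneg` and, through it, the owner's `B13ReadingsRecord`); edits nothing; defines NO
species reading (R41: W1 is the owner's).  Summits-side new work under the LEAN PLACEMENT RULE (bookkeeping; 0 def; 0 cite tags — printed KIND only).
HONEST FRAMING: rung (B)+1 of the FINITE-VOLUME T⁴ continuum programme — NOT infinite volume, NOT a mass gap, NOT the Clay problem, and **NOT A PROOF OF
NE5** (NOT PRINTED: the series prints ε-UNIFORM bounds, never η-RATES; cell GAPS G-t4-U3-1), NOT a proof of NE2 or NE3: every theorem is an IMPLICATION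
whose wall binders are DISPLAYED HYPOTHESES asserted nowhere — among them W2-op at factor level, `ActOpLineAnalyticOn` (GAPS G-ne5p1-1′∕1″, NOT PRINTED).
HONEST DEPENDENCY (cell line, verbatim): continuum YM on T⁴ ⇐ BetaPertH ∧ nine spine estimates (0/9 proved); BetaPertH ⇐ (D1) ∧ (D4) ∧ CAP+tail;
G-an2-4 gates asym, D1 and NE2/3/4.

WHAT THIS FILE DOES (compositions BY NAME; no analytic estimate of its own).  On the carriers OF RECORD (`R : B13Carriers.TwoRuns 𝔾`), for slots
`S₀ : B13StepOfRecord.Slots R (Species …) IOp Hist` whose raw suppliers ARE the kernels of raw species (slot lines `hSA`∕`hSB` — `rfl` at the substrate's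
`slotsOfRecord`) and a ℂ-submodule `M ∋` both runs' operator data of record (R20; `M := measOp` at the substrate), the `hwer` binder of the E9[rec,sub]
faces is SUPPLIED by the owner's record face `B13ReadingsRecord.weightedEntrywiseRate_record_balaban_ne3Shape` — so it is REPLACED, on every face below,
by node U1b's `NE3Shape (minActReadings d 𝒞 L N dom (ne2Loc …)) Cn θ` (OPEN, row NE3), the (3.35)-class `hreg`, `0 ≤ α, β, Cn`, the threshold
`α, β ≤ η ≤ etaStar`, the O1 LETTERS of the five species (decay `hdec₁∕hdecΦ∕hdecΨ`, op-Lipschitz `hΦ∕hS₂`, `hΨ∕hS₃`, tower readings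
`ReadsTowerCov∕Delta∕GammaA∕B` over the model's OWN background type `R.carriers.BgB` via `tow : ℕ → (ℕ → ℝ) → R.carriers.BgB → ↥dom`, dominations,
`PotQ∕PotRLipschitzReading`, `Λ₂, …, Λ₅ ≥ 0`) and the two slot lines; input rate `Θ := √(max θ L⁻¹)` (`0 < Θ < 1` by `sqrt_rate_pos_lt_one`, no rate
binder; `hc₁` discharged by `c1_balaban_nonneg`); W4 `InsertionRate` displayed at `Θ`.
* §1 **`exists_ne5_of_record_restrict_envelope_balaban_ne3Shape`** — PER PAIR OF RUNS, PER SUB-SLOT: this lineage's letters-free E9[rec,sub]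
  `B13StepEnvelopeEndSub.exists_ne5_of_record_restrict_envelope_actNormDecay S₀ M hMA hMB E₀ cB` with `hwer` fed; conclusion LITERALLY
  `∃ C₅, T4OutputRate.NE5 (B13StepOfRecord.outA S₀ E₀ cB) (B13StepOfRecord.outB S₀ E₀ cB) W κ θ′ C₅`.
* §2 **`uniform_ne5_of_record_restrict_envelope_balaban_ne3Shape`** — ONE `C₅` from the SIZES ONLY (`κ, Φ′, EA₀, E₀, cA, cB, r₀, δ′, θ′, ω`, the
  letters of W1's constant `o, d, L, a, α, β, Cn, a′, B₁, B₂, B₃, Λ₂, …, Λ₅`, U1b's rate letter `θ < 1`) for EVERY pair of runs, slot package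
  (`S₀.D.ω = ω`), sub-slot `M ∋` the data of record, admissible data `dom ∕ 𝒞 ∕ N ∕ RgV` in U1b's shape at `(Cn, θ)`, species tables, towers, window, roomy
  class, activity-norm majorants `A∕A′` (decay split + anchored norm `Φ′`), `ActOpLineAnalyticOn`∕`ActExpLinearOn` datum over `↥M` — this lineage's
  `B13StepEnvelopeEndUniform.uniform_ne5_of_record_restrict_envelope` at `c₁ :=` W1's assembled constant, `θ := Θ`, its W1 binder supplied per pair
  of runs by the owner's record face.
So on the E9 road too the terminal face displays ONLY `NE3Shape` + class ∕ threshold + O1 letters + slot lines + `TransportReads` + W3 slice budgets +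
L05∕L06 + `RawBounded` ×2 + floor + W4 `InsertionRate` + room ×2 + the activity-norm majorant with decay split ∕ anchored norm (`0 ≤ Φ′`, `36Φ′ < 1`)
+ **`ActOpLineAnalyticOn`** (W2-op, factor level, over directions IN `M`) + `ActExpLinearOn` + signs + `Θ ≤ θ′ ≤ 1`, `0 < ω < 1` and the TWO STRICT
SIZE INEQUALITIES `cA(EA₀ + E₀) < 1 − ω`, `ω + (Φ′∕(1 − 36Φ′))·cA·(1 − ω)∕(1 − ω − cA(EA₀ + E₀)) < θ′` — no `hwer`, no rate binder, no `ρ₀∕k₀∕B`,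
no chart.  NOT decided here: whether Bałaban's constants satisfy the two inequalities (every letter O(1)-symbolic in print; leaf-10's
`B13SmallnessCensus.md`); 0∕12 leaves on Bałaban's concrete objects (O1 = substrate cell); spine 0∕9.  `FlowStep.BetaPertH`, (B), (B^μ) do not occur.
0 sorry; no new axioms.
-/

noncomputable section

open scoped BigOperators Matrix.Norms.L2Operator
open Metric Set

namespace Summit.QuantumFields.BalabanUV.T4Continuum.B13StepEnvelopeEndBalaban

open Literature.MathematicalPhysics.QuantumFieldTheory.Balaban1983to89
open Literature.MathematicalPhysics.QuantumFieldTheory.Balaban1983to89.T4OutputRate (Carriers Functional DecayBound NE5)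
open Literature.MathematicalPhysics.QuantumFieldTheory.Balaban1983to89.T4InputCauchyRateData (StepModel)
open Literature.MathematicalPhysics.QuantumFieldTheory.Balaban1983to89.T4InputCauchyRateSpecies (ballClass)
open Literature.MathematicalPhysics.QuantumFieldTheory.Balaban1983to89.B5Prop11Plancherel (Cst Tor fine)
open Literature.MathematicalPhysics.QuantumFieldTheory.Balaban1983to89.B5G183RateUnitTower (lev lev_neZero)
open Literature.MathematicalPhysics.QuantumFieldTheory.Balaban1983to89.T4EtaRateMin (NE3Shape)
open Summit.QuantumFields.BalabanUV.T4Continuum.B13Carriers (TwoRuns)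
open Summit.QuantumFields.BalabanUV.T4Continuum.B13OpDatum (OpDatum Format Species RawSpecies)
open Summit.QuantumFields.BalabanUV.T4Continuum.B13OpDatumJunctions (opOf RawBounded WeightedEntrywiseRate)
open Summit.QuantumFields.BalabanUV.T4Continuum.B13StepTermLabels (TermIdx InnerLabel)
open Summit.QuantumFields.BalabanUV.T4Continuum.B13StepTermFamily (ActData ActExpLinearOn)
open Summit.QuantumFields.BalabanUV.T4Continuum.B13StepTermSocket (labelsIndexing)
open Summit.QuantumFields.BalabanUV.T4Continuum.B13InnerData (Bnd b13InnerData)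
open Summit.QuantumFields.BalabanUV.T4Continuum.UrsellTreeSum (ind)
open Summit.QuantumFields.BalabanUV.T4Continuum.UrsellTermBudget (actSum)
open Summit.QuantumFields.BalabanUV.T4Continuum.B13Base (selfCtr)
open Summit.QuantumFields.BalabanUV.T4Continuum.B13DomainGeometryTR (SCube footprint domainGeometry)
open Summit.QuantumFields.BalabanUV.T4Continuum.B13StepOfRecord (Slots assembly step outA outB)
open Summit.QuantumFields.BalabanUV.T4Continuum.B13StepOfRecordSub (assemblyOn restrict)
open Summit.QuantumFields.BalabanUV.T4Continuum.B13TermOpEnvelope (ActOpLineAnalyticOn)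
open Summit.QuantumFields.BalabanUV.T4Continuum.B13StepEnvelopeEndSub (exists_ne5_of_record_restrict_envelope_actNormDecay)
open Summit.QuantumFields.BalabanUV.T4Continuum.B13StepEnvelopeEndUniform (uniform_ne5_of_record_restrict_envelope)
open Summit.QuantumFields.BalabanUV.T4Continuum.B13StepEndInsOpBalaban (sqrt_rate_pos_lt_one c1_balaban_nonneg)
open Summit.QuantumFields.BalabanUV.T4Continuum.B13ReadingsDecay (ReadsTowerCovA ReadsTowerCovB CovWeightDominatesDist)
open Summit.QuantumFields.BalabanUV.T4Continuum.B13ReadingsImage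
open Summit.QuantumFields.BalabanUV.T4Continuum.B13ReadingsLocal (PotQLipschitzReading PotRLipschitzReading)
open Summit.QuantumFields.BalabanUV.T4Continuum.B13ReadingsAssembly (CpertRec)
open Summit.QuantumFields.BalabanUV.T4Continuum.B13ReadingsRecord (weightedEntrywiseRate_record_balaban_ne3Shape)
open Summit.QuantumFields.BalabanUV.T4Continuum.DecayRateInterpolation (EntryDecay)
open Summit.QuantumFields.BalabanUV.T4Continuum.BalabanAveragedTowerUnit (idx)
open Summit.QuantumFields.BalabanUV.T4Continuum.GaugeTermScalarData (QuT Q1)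
open Summit.QuantumFields.BalabanUV.T4Continuum.RegularSiteTransporters (siteT)
open Summit.QuantumFields.BalabanUV.T4Continuum.RegularBackgroundTower (RegularTransporters)
open Summit.QuantumFields.BalabanUV.T4Continuum.NE2ColourPerturbedLayer (pertCovC)
open Summit.QuantumFields.BalabanUV.T4Continuum.NE2BalabanRoot (balabanPert)
open Summit.QuantumFields.BalabanUV.T4Continuum.NE2BalabanGauge (gaugeSlot liftR)
open Summit.QuantumFields.BalabanUV.T4Continuum.NE2BalabanThreshold (etaStar)
open Summit.QuantumFields.BalabanUV.T4Continuum.NE2FromNE3Carrier (ne2Loc)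
open Summit.QuantumFields.BalabanUV.T4Continuum.MinimalActionRate (minActReadings)

section Balaban

variable {d : ℕ} (L : ℕ) [NeZero L] (Mf : Fin d → ℕ) [hM : ∀ μ, NeZero (Mf μ)] {o : Type*} [Fintype o] [DecidableEq o] (a : ℝ) (ha : 0 < a)
variable {α β Cn a' η θ : ℝ} {Ts Ks Is Ωs Ys m : Type*} [Fintype m] [DecidableEq m]
variable {𝒞 : ℕ → Set (B7Prop1Explicit.Site d → Fin d → (Matrix o o ℂ)ˣ)} {N : ℕ}
  {dom : Set (B7Prop1Explicit.Site d → Fin d → (Matrix o o ℂ)ˣ)}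
  {RgV : (B7Prop1Explicit.Site d → Fin d → (Matrix o o ℂ)ˣ) → ((k : ℕ) → Fin d → (Tor (fine (lev L k) Mf) → Matrix o o ℂ))}

/-! ## §1 Per pair of runs, per sub-slot: E9[rec,sub] with W1 produced at Bałaban's tier-B background, arithmetic letters eliminated -/

/-- [folklore] **THE CAUCHY-ENVELOPE END OF RECORD OVER A SUB-SLOT, W1 PRODUCED AT BAŁABAN's TIER-B BACKGROUND, ARITHMETIC LETTERS ELIMINATED**
— `B13StepEnvelopeEndSub.exists_ne5_of_record_restrict_envelope_actNormDecay S₀ M hMA hMB E₀ cB` (E9[rec,sub], letters-free) for any pair of runs `R`,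
any slots `S₀` with species entries and any ℂ-submodule `M ∋` the operator data of record, with `hwer ∕ hc₁ ∕ hθ0 ∕ hθ1` REPLACED by the slot lines
`hSA`∕`hSB` and the owner's `weightedEntrywiseRate_record_balaban_ne3Shape` inputs VERBATIM (run A read at `R.carriers.transport U`).  Input rate
`√(max θ L⁻¹)`; W4 displayed at that rate; conclusion at the PRESCRIBED `θ′`, LITERALLY `∃ C₅, NE5 (outA S₀ E₀ cB) (outB S₀ E₀ cB) W κ θ′ C₅`.
NOT a proof of NE5 ∕ NE2 ∕ NE3: an implication from displayed binders (W2-op `ActOpLineAnalyticOn` over `↥M` among them). -/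
theorem exists_ne5_of_record_restrict_envelope_balaban_ne3Shape {𝔾 : Type} [GaugeGroup 𝔾] {R : TwoRuns 𝔾} {IOp Hist Ω : Type*}
    [NormedAddCommGroup Hist] [NormedSpace ℂ Hist] [MeasurableSpace Ω]
    (S₀ : Slots R (Species Ts Ks Is Ωs Ys) IOp Hist) (M : Submodule ℂ (OpDatum (Species Ts Ks Is Ωs Ys)))
    (hMA : ∀ g V k, opOf S₀.F S₀.rawA g V k ∈ M) (hMB : ∀ g U k, opOf S₀.F S₀.rawB g U k ∈ M) (E₀ cB : ℝ)
    -- the species tables of the two runs and the two slot identifications ([dict], displayed; `rfl` at the substrate's `slotsOfRecord`)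
    {rawA₀ : (ℕ → ℝ) → R.carriers.BgA → ℕ → RawSpecies Ts Ks Is Ωs Ys} {rawB₀ : (ℕ → ℝ) → R.carriers.BgB → ℕ → RawSpecies Ts Ks Is Ωs Ys}
    (hSA : ∀ g V k, S₀.rawA g V k = (rawA₀ g V k).kernel) (hSB : ∀ g U k, S₀.rawB g U k = (rawB₀ g U k).kernel) (hL : 2 ≤ L) (hd : 1 ≤ d)
    -- node U1b's shape, the (3.35)-class, the threshold
    (hreg : ∀ V ∈ dom, RegularTransporters L Mf (liftR L Mf (RgV V)) α β) (hα : 0 ≤ α) (hβ : 0 ≤ β) (hC : 0 ≤ Cn)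
    (hNE3 : NE3Shape (minActReadings d 𝒞 L N dom (ne2Loc L Mf fun V => liftR L Mf (RgV V))) Cn θ)
    (ha' : 0 < a') (hαη : α ≤ η) (hβη : β ≤ η) (hη : η ≤ etaStar o d a a')
    -- the towers over the model's run-B background type (the reading map IS the chart into node NE3's admissible data)
    {tow : ℕ → (ℕ → ℝ) → R.carriers.BgB → ↥dom} {W : Set (ℕ → ℝ)}
    -- the covariance species
    {σ : Ts → Ks → idx L Mf 0 × o} {dist₁ : idx L Mf 0 × o → idx L Mf 0 × o → ℝ} {B₁ δ₁ : ℝ}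
    (hdec₁ : ∀ V ∈ dom, ∀ k, EntryDecay dist₁
      (pertCovC L Mf a ha (balabanPert L Mf a (liftR L Mf (RgV V)) (gaugeSlot L Mf (RgV V) (QuT L Mf o (siteT L Mf (RgV V))) (Q1 L Mf o) a'))
        1 k) B₁ δ₁)
    (hcovA : ReadsTowerCovA
      (fun V : ↥dom => pertCovC L Mf a ha
        (balabanPert L Mf a (liftR L Mf (RgV V)) (gaugeSlot L Mf (RgV V) (QuT L Mf o (siteT L Mf (RgV V))) (Q1 L Mf o) a')) 1)
      σ tow (fun g U k => rawA₀ g (R.carriers.transport U) k) W)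
    (hcovB : ReadsTowerCovB
      (fun V : ↥dom => pertCovC L Mf a ha
        (balabanPert L Mf a (liftR L Mf (RgV V)) (gaugeSlot L Mf (RgV V) (QuT L Mf o (siteT L Mf (RgV V))) (Q1 L Mf o) a')) 1)
      σ tow rawB₀ W)
    (hdom₁ : CovWeightDominatesDist S₀.F dist₁ σ (δ₁ / 2))
    -- the `deltaKer` species
    {S₂ : Set (Matrix (idx L Mf 0 × o) (idx L Mf 0 × o) ℂ)} {Φ : Ts → Matrix (idx L Mf 0 × o) (idx L Mf 0 × o) ℂ → Matrix m m ℂ}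
    {Λ₂ : ℝ} (hΦ : ∀ t, OpLipschitzOn S₂ (Φ t) Λ₂) (hΛ₂ : 0 ≤ Λ₂)
    (hS₂ : ∀ V ∈ dom, ∀ k, pertCovC L Mf a ha
      (balabanPert L Mf a (liftR L Mf (RgV V)) (gaugeSlot L Mf (RgV V) (QuT L Mf o (siteT L Mf (RgV V))) (Q1 L Mf o) a')) 1 k ∈ S₂)
    {dist₂ : m → m → ℝ} {B₂ δ₂ : ℝ}
    (hdecΦ : ∀ V ∈ dom, ∀ t k, EntryDecay dist₂ (Φ t (pertCovC L Mf a ha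
      (balabanPert L Mf a (liftR L Mf (RgV V)) (gaugeSlot L Mf (RgV V) (QuT L Mf o (siteT L Mf (RgV V))) (Q1 L Mf o) a')) 1 k)) B₂ δ₂)
    {σX : Ts → Is → m}
    (hΔA : ReadsTowerDeltaA (fun (V : ↥dom) t k => Φ t (pertCovC L Mf a ha
      (balabanPert L Mf a (liftR L Mf (RgV V)) (gaugeSlot L Mf (RgV V) (QuT L Mf o (siteT L Mf (RgV V))) (Q1 L Mf o) a')) 1 k))
      σX tow (fun g U k => rawA₀ g (R.carriers.transport U) k) W)
    (hΔB : ReadsTowerDeltaB (fun (V : ↥dom) t k => Φ t (pertCovC L Mf a ha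
      (balabanPert L Mf a (liftR L Mf (RgV V)) (gaugeSlot L Mf (RgV V) (QuT L Mf o (siteT L Mf (RgV V))) (Q1 L Mf o) a')) 1 k))
      σX tow rawB₀ W)
    (hdom₂ : DeltaWeightDominatesDist S₀.F dist₂ σX (δ₂ / 2))
    -- the `gammaConstituent` species
    {S₃ : Set (Matrix (idx L Mf 0 × o) (idx L Mf 0 × o) ℂ)} {Ψ : Ts → Matrix (idx L Mf 0 × o) (idx L Mf 0 × o) ℂ → Matrix m m ℂ}
    {Λ₃ : ℝ} (hΨ : ∀ t, OpLipschitzOn S₃ (Ψ t) Λ₃) (hΛ₃ : 0 ≤ Λ₃)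
    (hS₃ : ∀ V ∈ dom, ∀ k, pertCovC L Mf a ha
      (balabanPert L Mf a (liftR L Mf (RgV V)) (gaugeSlot L Mf (RgV V) (QuT L Mf o (siteT L Mf (RgV V))) (Q1 L Mf o) a')) 1 k ∈ S₃)
    {dist₃ : m → m → ℝ} {B₃ δ₃ : ℝ}
    (hdecΨ : ∀ V ∈ dom, ∀ t k, EntryDecay dist₃ (Ψ t (pertCovC L Mf a ha
      (balabanPert L Mf a (liftR L Mf (RgV V)) (gaugeSlot L Mf (RgV V) (QuT L Mf o (siteT L Mf (RgV V))) (Q1 L Mf o) a')) 1 k)) B₃ δ₃)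
    {σB : Ts → Ks → m}
    (hΓA : ReadsTowerGammaA (fun (V : ↥dom) t k => Ψ t (pertCovC L Mf a ha
      (balabanPert L Mf a (liftR L Mf (RgV V)) (gaugeSlot L Mf (RgV V) (QuT L Mf o (siteT L Mf (RgV V))) (Q1 L Mf o) a')) 1 k))
      σB σX tow (fun g U k => rawA₀ g (R.carriers.transport U) k) W)
    (hΓB : ReadsTowerGammaB (fun (V : ↥dom) t k => Ψ t (pertCovC L Mf a ha
      (balabanPert L Mf a (liftR L Mf (RgV V)) (gaugeSlot L Mf (RgV V) (QuT L Mf o (siteT L Mf (RgV V))) (Q1 L Mf o) a')) 1 k))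
      σB σX tow rawB₀ W)
    (hdom₃ : GammaWeightDominatesDist S₀.F dist₃ σB σX (δ₃ / 2))
    -- the potential species
    {Λ₄ Λ₅ : ℝ} (hΛ₄ : 0 ≤ Λ₄) (hΛ₅ : 0 ≤ Λ₅)
    (hQ : PotQLipschitzReading (minActReadings d 𝒞 L N dom (ne2Loc L Mf fun V => liftR L Mf (RgV V))) S₀.F
      (fun g U k => rawA₀ g (R.carriers.transport U) k) rawB₀ W Λ₄)
    (hR : PotRLipschitzReading (minActReadings d 𝒞 L N dom (ne2Loc L Mf fun V => liftR L Mf (RgV V))) S₀.F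
      (fun g U k => rawA₀ g (R.carriers.transport U) k) rawB₀ W Λ₅)
    -- the rest of E9[rec,sub], BY NAME from `B13StepEnvelopeEndSub.exists_ne5_of_record_restrict_envelope_actNormDecay`
    {ROp RHist : ℕ → ℝ} {A A' : ℕ → (ℕ → ℝ) → R.carriers.BgB → R.carriers.Dom → InnerLabel R.carriers.Dom (Bnd R) → ℝ}
    {Dt : ActData R.carriers.Dom (InnerLabel R.carriers.Dom (Bnd R)) M Hist Ω} {κ Φ' EA₀ cA r₀ δ' θ' : ℝ}
    (hT : (assembly S₀).TransportReads W)
    (hbB : (assembly S₀).SliceBudgetB W κ cB) (hbA : S₀.D.SliceBudget (step S₀ E₀ cB) W κ cA)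
    (hdA : DecayBound (outA S₀ E₀ cB) W EA₀ κ) (hdB : DecayBound (outB S₀ E₀ cB) W E₀ κ)
    (hRA : RawBounded S₀.F (assembly S₀).rawAt W) (hRB : RawBounded S₀.F S₀.rawB W) (hfl : ∀ k, r₀ ≤ S₀.rOp k)
    (hins : (step S₀ E₀ cB).InsertionRate W κ E₀ δ' (Real.sqrt (max θ ((L : ℝ)⁻¹))))
    (hOp : ∀ k, S₀.rOp k ≤ ROp k) (hHist : ∀ k, (assembly S₀).bHist E₀ cB k + S₀.rHist k ≤ RHist k)
    (hA : ∀ k, ∀ g ∈ W, ∀ (U : R.carriers.BgB) (q : M × Hist),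
      q ∈ ballClass (selfCtr (assemblyOn (restrict S₀ M hMA hMB)).raw (assemblyOn (restrict S₀ M hMA hMB)).histRef) ROp RHist k g U →
        ∀ X : R.carriers.Dom, R.carriers.scale X = k → ∀ i : TermIdx R.carriers.Dom (Bnd R),
          (labelsIndexing (domainGeometry R) (b13InnerData R)).Rel k i X → ∀ m,
            ‖S₀.act ((labelsIndexing (domainGeometry R) (b13InnerData R)).poly i m)
                ((labelsIndexing (domainGeometry R) (b13InnerData R)).lab i m) (q.1 : OpDatum (Species Ts Ks Is Ωs Ys)) q.2‖ ≤
              A k g U ((labelsIndexing (domainGeometry R) (b13InnerData R)).poly i m)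
                ((labelsIndexing (domainGeometry R) (b13InnerData R)).lab i m))
    (hA0 : ∀ k g U Z ℓ, 0 ≤ A k g U Z ℓ) (hA0' : ∀ k g U Z ℓ, 0 ≤ A' k g U Z ℓ) (hκ : 0 ≤ κ)
    (hdec : ∀ k g U Z ℓ, A k g U Z ℓ ≤ A' k g U Z ℓ * Real.exp (-(κ * (R.carriers.d Z + 5))))
    (hΦ0 : 0 ≤ Φ') (hΦsmall : 36 * Φ' < 1)
    (hΦ' : ∀ k, ∀ g ∈ W, ∀ (U : R.carriers.BgB) (q : SCube R),
      ∑ Z ∈ R.domAt k, ind (q ∈ footprint Z) * actSum (b13InnerData R) (A' k g U) k Z * Real.exp ((footprint Z).card) ≤ Φ')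
    (hact : ActOpLineAnalyticOn (labelsIndexing (domainGeometry R) (b13InnerData R)) (restrict S₀ M hMA hMB).act
      (ballClass (selfCtr (assemblyOn (restrict S₀ M hMA hMB)).raw (assemblyOn (restrict S₀ M hMA hMB)).histRef) ROp RHist) W)
    (hexp : ActExpLinearOn (labelsIndexing (domainGeometry R) (b13InnerData R)) (restrict S₀ M hMA hMB).act Dt
      (ballClass (selfCtr (assemblyOn (restrict S₀ M hMA hMB)).raw (assemblyOn (restrict S₀ M hMA hMB)).histRef) ROp RHist) W)
    (hE₀ : 0 ≤ E₀) (hcA : 0 ≤ cA) (hcB : 0 ≤ cB) (hr₀ : 0 < r₀) (hδ' : 0 ≤ δ')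
    (hθθ' : Real.sqrt (max θ ((L : ℝ)⁻¹)) ≤ θ') (hθ'1 : θ' ≤ 1) (hω : 0 < S₀.D.ω) (hω1 : S₀.D.ω < 1)
    (hh : cA * (EA₀ + E₀) < 1 - S₀.D.ω)
    (hsmall : S₀.D.ω + Φ' / (1 - 36 * Φ') * cA * (1 - S₀.D.ω) / (1 - S₀.D.ω - cA * (EA₀ + E₀)) < θ') :
    ∃ C₅, NE5 (outA S₀ E₀ cB) (outB S₀ E₀ cB) W κ θ' C₅ :=
  exists_ne5_of_record_restrict_envelope_actNormDecay S₀ M hMA hMB E₀ cB hT hbB hbA hdA hdB hRA hRB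
    (weightedEntrywiseRate_record_balaban_ne3Shape L Mf a ha S₀ hSA hSB hL hd hreg hα hβ hC hNE3 ha' hαη hβη hη hdec₁ hcovA hcovB hdom₁ hΦ
      hΛ₂ hS₂ hdecΦ hΔA hΔB hdom₂ hΨ hΛ₃ hS₃ hdecΨ hΓA hΓB hdom₃ hΛ₄ hΛ₅ hQ hR)
    hfl hins hOp hHist hA hA0 hA0' hκ hdec hΦ0 hΦsmall hΦ' hact hexp hE₀ hcA hcB (c1_balaban_nonneg L a hC hΛ₄ hΛ₅) hr₀ hδ'
    (sqrt_rate_pos_lt_one L hL hNE3.rate_lt_one).1 (sqrt_rate_pos_lt_one L hL hNE3.rate_lt_one).2 hθθ' hθ'1 hω hω1 hh hsmall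

/-! ## §2 One constant for every pair of runs and every sub-slot containing the data of record (η-uniformity) -/

/-- [folklore] **ONE CONSTANT FOR EVERY PAIR OF RUNS AND SUB-SLOT (η-UNIFORMITY), W1 PRODUCED AT BAŁABAN's TIER-B BACKGROUND, LETTERS ELIMINATED**
— this lineage's `B13StepEnvelopeEndUniform.uniform_ne5_of_record_restrict_envelope` with its W1 binder supplied per pair of runs by the owner's record
face.  Fix the SIZES (`κ, Φ′, EA₀, E₀, cA, cB, r₀, δ′, θ′, ω`, the letters of W1's constant `o, d, L, a, α, β, Cn, a′, B₁, B₂, B₃, Λ₂, …, Λ₅`, and U1b's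
`θ < 1` — here a SIZE, since `C₅` is chosen before the data), subject to `√(max θ L⁻¹) ≤ θ′ ≤ 1`, `0 ≤ Φ′`, `36Φ′ < 1` and the TWO STRICT SIZE
INEQUALITIES.  Then ONE `C₅` serves EVERY pair of runs `R : TwoRuns 𝔾`, slot package `S₀` (species format `S₀.F`, `S₀.D.ω = ω`), sub-slot `M ∋` the
operator data of record, admissible data `dom ∕ 𝒞 ∕ N ∕ RgV` in the (3.35)-class and in U1b's shape `NE3Shape … Cn θ`, species tables `rawA₀ ∕ rawB₀`
(slot lines), towers `tow` over `R.carriers.BgB`, O1 letters, window, roomy class, activity-norm majorants `A ∕ A′` with decay split and anchored norm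
`Φ′`, W2 data `ActOpLineAnalyticOn` ∕ `ActExpLinearOn` over `↥M`: the displayed binders IMPLY `NE5 (outA S₀ E₀ cB) (outB S₀ E₀ cB) W κ θ′ C₅`.
NOT a proof of NE5 ∕ NE2 ∕ NE3: an implication from displayed binders, the quantifier order `∃ C₅, ∀ …` being the point. -/
theorem uniform_ne5_of_record_restrict_envelope_balaban_ne3Shape (hL : 2 ≤ L) (hd : 1 ≤ d) (hα : 0 ≤ α) (hβ : 0 ≤ β) (hC : 0 ≤ Cn)
    (ha' : 0 < a') (hαη : α ≤ η) (hβη : β ≤ η) (hη : η ≤ etaStar o d a a') {B₁ B₂ B₃ Λ₂ Λ₃ Λ₄ Λ₅ : ℝ} (hΛ₂ : 0 ≤ Λ₂) (hΛ₃ : 0 ≤ Λ₃)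
    (hΛ₄ : 0 ≤ Λ₄) (hΛ₅ : 0 ≤ Λ₅) (hθ1 : θ < 1) {κ Φ' EA₀ E₀ cA cB r₀ δ' θ' ω : ℝ}
    (hE₀ : 0 ≤ E₀) (hκ : 0 ≤ κ) (hΦ0 : 0 ≤ Φ') (hΦsmall : 36 * Φ' < 1) (hcA : 0 ≤ cA) (hcB : 0 ≤ cB) (hr₀ : 0 < r₀) (hδ' : 0 ≤ δ')
    (hθθ' : Real.sqrt (max θ ((L : ℝ)⁻¹)) ≤ θ') (hθ'1 : θ' ≤ 1) (hω : 0 < ω) (hω1 : ω < 1)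
    (hh : cA * (EA₀ + E₀) < 1 - ω) (hsmall : ω + Φ' / (1 - 36 * Φ') * cA * (1 - ω) / (1 - ω - cA * (EA₀ + E₀)) < θ') :
    ∃ C₅ : ℝ, ∀ {𝔾 : Type} [GaugeGroup 𝔾] {R : TwoRuns 𝔾} {IOp' Hist' Ω' : Type*} [NormedAddCommGroup Hist'] [NormedSpace ℂ Hist']
      [MeasurableSpace Ω']
      (S₀ : Slots R (Species Ts Ks Is Ωs Ys) IOp' Hist') (M : Submodule ℂ (OpDatum (Species Ts Ks Is Ωs Ys)))
      (hMA : ∀ g V k, opOf S₀.F S₀.rawA g V k ∈ M) (hMB : ∀ g U k, opOf S₀.F S₀.rawB g U k ∈ M)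
      {𝒞 : ℕ → Set (B7Prop1Explicit.Site d → Fin d → (Matrix o o ℂ)ˣ)} {N : ℕ}
      {dom : Set (B7Prop1Explicit.Site d → Fin d → (Matrix o o ℂ)ˣ)}
      {RgV : (B7Prop1Explicit.Site d → Fin d → (Matrix o o ℂ)ˣ) → ((k : ℕ) → Fin d → (Tor (fine (lev L k) Mf) → Matrix o o ℂ))}
      {rawA₀ : (ℕ → ℝ) → R.carriers.BgA → ℕ → RawSpecies Ts Ks Is Ωs Ys} {rawB₀ : (ℕ → ℝ) → R.carriers.BgB → ℕ → RawSpecies Ts Ks Is Ωs Ys}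
      {tow : ℕ → (ℕ → ℝ) → R.carriers.BgB → ↥dom} {W : Set (ℕ → ℝ)}
      {σ : Ts → Ks → idx L Mf 0 × o} {dist₁ : idx L Mf 0 × o → idx L Mf 0 × o → ℝ} {δ₁ : ℝ}
      {S₂ : Set (Matrix (idx L Mf 0 × o) (idx L Mf 0 × o) ℂ)} {Φ : Ts → Matrix (idx L Mf 0 × o) (idx L Mf 0 × o) ℂ → Matrix m m ℂ}
      {dist₂ : m → m → ℝ} {δ₂ : ℝ} {σX : Ts → Is → m}
      {S₃ : Set (Matrix (idx L Mf 0 × o) (idx L Mf 0 × o) ℂ)} {Ψ : Ts → Matrix (idx L Mf 0 × o) (idx L Mf 0 × o) ℂ → Matrix m m ℂ}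
      {dist₃ : m → m → ℝ} {δ₃ : ℝ} {σB : Ts → Ks → m}
      {ROp RHist : ℕ → ℝ} {A A' : ℕ → (ℕ → ℝ) → R.carriers.BgB → R.carriers.Dom → InnerLabel R.carriers.Dom (Bnd R) → ℝ}
      {Dt : ActData R.carriers.Dom (InnerLabel R.carriers.Dom (Bnd R)) M Hist' Ω'},
      S₀.D.ω = ω →
      (∀ V ∈ dom, RegularTransporters L Mf (liftR L Mf (RgV V)) α β) →
      NE3Shape (minActReadings d 𝒞 L N dom (ne2Loc L Mf fun V => liftR L Mf (RgV V))) Cn θ →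
      (∀ g V k, S₀.rawA g V k = (rawA₀ g V k).kernel) → (∀ g U k, S₀.rawB g U k = (rawB₀ g U k).kernel) →
      (∀ V ∈ dom, ∀ k, EntryDecay dist₁
        (pertCovC L Mf a ha (balabanPert L Mf a (liftR L Mf (RgV V)) (gaugeSlot L Mf (RgV V) (QuT L Mf o (siteT L Mf (RgV V))) (Q1 L Mf o) a'))
          1 k) B₁ δ₁) →
      ReadsTowerCovA
        (fun V : ↥dom => pertCovC L Mf a ha
          (balabanPert L Mf a (liftR L Mf (RgV V)) (gaugeSlot L Mf (RgV V) (QuT L Mf o (siteT L Mf (RgV V))) (Q1 L Mf o) a')) 1)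
        σ tow (fun g U k => rawA₀ g (R.carriers.transport U) k) W →
      ReadsTowerCovB
        (fun V : ↥dom => pertCovC L Mf a ha
          (balabanPert L Mf a (liftR L Mf (RgV V)) (gaugeSlot L Mf (RgV V) (QuT L Mf o (siteT L Mf (RgV V))) (Q1 L Mf o) a')) 1)
        σ tow rawB₀ W →
      CovWeightDominatesDist S₀.F dist₁ σ (δ₁ / 2) →
      (∀ t, OpLipschitzOn S₂ (Φ t) Λ₂) →
      (∀ V ∈ dom, ∀ k, pertCovC L Mf a ha
        (balabanPert L Mf a (liftR L Mf (RgV V)) (gaugeSlot L Mf (RgV V) (QuT L Mf o (siteT L Mf (RgV V))) (Q1 L Mf o) a')) 1 k ∈ S₂) →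
      (∀ V ∈ dom, ∀ t k, EntryDecay dist₂ (Φ t (pertCovC L Mf a ha
        (balabanPert L Mf a (liftR L Mf (RgV V)) (gaugeSlot L Mf (RgV V) (QuT L Mf o (siteT L Mf (RgV V))) (Q1 L Mf o) a')) 1 k)) B₂ δ₂) →
      ReadsTowerDeltaA (fun (V : ↥dom) t k => Φ t (pertCovC L Mf a ha
        (balabanPert L Mf a (liftR L Mf (RgV V)) (gaugeSlot L Mf (RgV V) (QuT L Mf o (siteT L Mf (RgV V))) (Q1 L Mf o) a')) 1 k))
        σX tow (fun g U k => rawA₀ g (R.carriers.transport U) k) W →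
      ReadsTowerDeltaB (fun (V : ↥dom) t k => Φ t (pertCovC L Mf a ha
        (balabanPert L Mf a (liftR L Mf (RgV V)) (gaugeSlot L Mf (RgV V) (QuT L Mf o (siteT L Mf (RgV V))) (Q1 L Mf o) a')) 1 k))
        σX tow rawB₀ W →
      DeltaWeightDominatesDist S₀.F dist₂ σX (δ₂ / 2) →
      (∀ t, OpLipschitzOn S₃ (Ψ t) Λ₃) →
      (∀ V ∈ dom, ∀ k, pertCovC L Mf a ha
        (balabanPert L Mf a (liftR L Mf (RgV V)) (gaugeSlot L Mf (RgV V) (QuT L Mf o (siteT L Mf (RgV V))) (Q1 L Mf o) a')) 1 k ∈ S₃) →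
      (∀ V ∈ dom, ∀ t k, EntryDecay dist₃ (Ψ t (pertCovC L Mf a ha
        (balabanPert L Mf a (liftR L Mf (RgV V)) (gaugeSlot L Mf (RgV V) (QuT L Mf o (siteT L Mf (RgV V))) (Q1 L Mf o) a')) 1 k)) B₃ δ₃) →
      ReadsTowerGammaA (fun (V : ↥dom) t k => Ψ t (pertCovC L Mf a ha
        (balabanPert L Mf a (liftR L Mf (RgV V)) (gaugeSlot L Mf (RgV V) (QuT L Mf o (siteT L Mf (RgV V))) (Q1 L Mf o) a')) 1 k))
        σB σX tow (fun g U k => rawA₀ g (R.carriers.transport U) k) W →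
      ReadsTowerGammaB (fun (V : ↥dom) t k => Ψ t (pertCovC L Mf a ha
        (balabanPert L Mf a (liftR L Mf (RgV V)) (gaugeSlot L Mf (RgV V) (QuT L Mf o (siteT L Mf (RgV V))) (Q1 L Mf o) a')) 1 k))
        σB σX tow rawB₀ W →
      GammaWeightDominatesDist S₀.F dist₃ σB σX (δ₃ / 2) →
      PotQLipschitzReading (minActReadings d 𝒞 L N dom (ne2Loc L Mf fun V => liftR L Mf (RgV V))) S₀.F
        (fun g U k => rawA₀ g (R.carriers.transport U) k) rawB₀ W Λ₄ →
      PotRLipschitzReading (minActReadings d 𝒞 L N dom (ne2Loc L Mf fun V => liftR L Mf (RgV V))) S₀.F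
        (fun g U k => rawA₀ g (R.carriers.transport U) k) rawB₀ W Λ₅ →
      (assembly S₀).TransportReads W →
      (assembly S₀).SliceBudgetB W κ cB → S₀.D.SliceBudget (step S₀ E₀ cB) W κ cA →
      DecayBound (outA S₀ E₀ cB) W EA₀ κ → DecayBound (outB S₀ E₀ cB) W E₀ κ →
      RawBounded S₀.F (assembly S₀).rawAt W → RawBounded S₀.F S₀.rawB W → (∀ k, r₀ ≤ S₀.rOp k) →
      (step S₀ E₀ cB).InsertionRate W κ E₀ δ' (Real.sqrt (max θ ((L : ℝ)⁻¹))) →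
      (∀ k, S₀.rOp k ≤ ROp k) → (∀ k, (assembly S₀).bHist E₀ cB k + S₀.rHist k ≤ RHist k) →
      (∀ k, ∀ g ∈ W, ∀ (U : R.carriers.BgB) (q : M × Hist'),
        q ∈ ballClass (selfCtr (assemblyOn (restrict S₀ M hMA hMB)).raw (assemblyOn (restrict S₀ M hMA hMB)).histRef) ROp RHist k g U →
          ∀ X : R.carriers.Dom, R.carriers.scale X = k → ∀ i : TermIdx R.carriers.Dom (Bnd R),
            (labelsIndexing (domainGeometry R) (b13InnerData R)).Rel k i X → ∀ m,
              ‖S₀.act ((labelsIndexing (domainGeometry R) (b13InnerData R)).poly i m)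
                  ((labelsIndexing (domainGeometry R) (b13InnerData R)).lab i m) (q.1 : OpDatum (Species Ts Ks Is Ωs Ys)) q.2‖ ≤
                A k g U ((labelsIndexing (domainGeometry R) (b13InnerData R)).poly i m)
                  ((labelsIndexing (domainGeometry R) (b13InnerData R)).lab i m)) →
      (∀ k g U Z ℓ, 0 ≤ A k g U Z ℓ) → (∀ k g U Z ℓ, 0 ≤ A' k g U Z ℓ) →
      (∀ k g U Z ℓ, A k g U Z ℓ ≤ A' k g U Z ℓ * Real.exp (-(κ * (R.carriers.d Z + 5)))) →
      (∀ k, ∀ g ∈ W, ∀ (U : R.carriers.BgB) (q : SCube R),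
        ∑ Z ∈ R.domAt k, ind (q ∈ footprint Z) * actSum (b13InnerData R) (A' k g U) k Z * Real.exp ((footprint Z).card) ≤ Φ') →
      ActOpLineAnalyticOn (labelsIndexing (domainGeometry R) (b13InnerData R)) (restrict S₀ M hMA hMB).act
        (ballClass (selfCtr (assemblyOn (restrict S₀ M hMA hMB)).raw (assemblyOn (restrict S₀ M hMA hMB)).histRef) ROp RHist) W →
      ActExpLinearOn (labelsIndexing (domainGeometry R) (b13InnerData R)) (restrict S₀ M hMA hMB).act Dt
        (ballClass (selfCtr (assemblyOn (restrict S₀ M hMA hMB)).raw (assemblyOn (restrict S₀ M hMA hMB)).histRef) ROp RHist) W →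
      NE5 (outA S₀ E₀ cB) (outB S₀ E₀ cB) W κ θ' C₅ := by
  obtain ⟨hΘ0, hΘ1⟩ := sqrt_rate_pos_lt_one L hL hθ1
  obtain ⟨C₅, hC₅⟩ := uniform_ne5_of_record_restrict_envelope (κ := κ) (Φ' := Φ')
    (c₁ := Real.sqrt (2 * B₁ * (2 * CpertRec o d L a α β Cn a' / (1 - max θ ((L : ℝ)⁻¹)))) +
      Real.sqrt (2 * B₂ * (Λ₂ * CpertRec o d L a α β Cn a')) + Real.sqrt (2 * B₃ * (Λ₃ * CpertRec o d L a α β Cn a')) +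
      Λ₄ * Cn + Λ₅ * Cn)
    hE₀ hκ hΦ0 hΦsmall hcA hcB (c1_balaban_nonneg L a hC hΛ₄ hΛ₅) hr₀ hδ' hΘ0 hΘ1 hθθ' hθ'1 hω hω1 hh hsmall
  refine ⟨C₅, ?_⟩
  intro 𝔾 _ R IOp' Hist' Ω' _ _ _ S₀ M hMA hMB 𝒞 N dom RgV rawA₀ rawB₀ tow W σ dist₁ δ₁ S₂ Φ dist₂ δ₂ σX S₃ Ψ dist₃ δ₃ σB ROp RHist A A' Dt
    hSω hreg hNE3 hSA hSB hdec₁ hcovA hcovB hdom₁ hΦ hS₂ hdecΦ hΔA hΔB hdom₂ hΨ hS₃ hdecΨ hΓA hΓB hdom₃ hQ hR hT hbB hbA hdA hdB hRA hRB hfl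
    hins hOp hHist hA hA0 hA0' hdec hΦ' hact hexp
  have hwer := weightedEntrywiseRate_record_balaban_ne3Shape L Mf a ha S₀ hSA hSB hL hd hreg hα hβ hC hNE3 ha' hαη hβη hη hdec₁ hcovA hcovB
    hdom₁ hΦ hΛ₂ hS₂ hdecΦ hΔA hΔB hdom₂ hΨ hΛ₃ hS₃ hdecΨ hΓA hΓB hdom₃ hΛ₄ hΛ₅ hQ hR
  exact hC₅ S₀ M hMA hMB hSω hT hbB hbA hdA hdB hRA hRB hwer hfl hins hOp hHist hA hA0 hA0' hdec hΦ' hact hexp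

end Balaban

end Summit.QuantumFields.BalabanUV.T4Continuum.B13StepEnvelopeEndBalaban

end
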